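import Summits.FinalStateConjecture.FinalStateConjecture.Theorems.LogTimeThreeAnnuliDyadicCaptureFreezingB
import Summits.FinalStateConjecture.FinalStateConjecture.Theorems.LogTimeThreeAnnuliDyadicCaptureDyadicSelection

/-!
# Route LogTimeThreeAnnuli · crux `DyadicCapture` · line `registered` — freezing assembly, part C

CONVERGENCE OF THE FITTED PARAMETERS for one instance `(k, ρ)` of the windowwise summability
hypothesis, and the identification of the limit across instances.

Abstract bookkeeping (`ℝ≥0∞`-valued window errors `eₙ` with finite terms and vanishing tails
`Tₙ = Σⱼ e_{j+n} → 0`): the series is finite (`freezing_tsum_ne_top_of_tail`); a sequence `Gₙ` in a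
complete normed group with `‖Gₙ − Gₙ₊₁‖ ≤ eₙ + eₙ₊₁` converges (`freezing_exists_tendsto_of_le`);
a function `Pv` of chart time with `‖Pv τ − Gₙ‖ ≤ eₙ` on the `n`-th dyadic window
`[2^(n₀+n), 2^(n₀+n+1)]` tends to the limit of `Gₙ` (`freezing_tendsto_of_window_bound`).

Concrete instance (`freezing_instance_limit`): for a smooth chart `Ψ` on the reference exterior, an
anchor `x₀ = c + Λy₀` inside the slab of radius `ρ`, window members `pₙ` with finite window errors and
vanishing tails, the anchor images `g_{pₙ}(x₀)` satisfy `‖g_{pₙ}(x₀) − g_{pₙ₊₁}(x₀)‖ ≤ eₙ + eₙ₊₁`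
(shared endpoint `2^(n₀+n+1)`, `freezing_enorm_anchor_sub_le`), hence `pₙ → pinf` in the window
(`freezing_tendsto_of_tendsto_anchor`), and the `p`-INDEPENDENT pullback value
`Pv τ = (Ψ^*g − g_q)(x₀ + τΛe₀) + g_q(x₀)` (`freezing_dev_anchor_eq`) tends to `g_{pinf}(x₀)`; since the
family is injective at the anchor, `pinf` does not depend on the instance
(`freezing_limit_unique`). Sources: Simon, Ann. Math. 118 (1983) (uniqueness of limits from summable
decay, the scheme); Kerr–Schild 1965 §2.
-/

-- the `Summit.FinalStateConjecture.FinalStateConjecture.…` namespace repeats the summit = sub-problem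
-- segment (D-0017 layout, CONVENTIONS §2); the duplicate is deliberate.
set_option linter.dupNamespace false

noncomputable section

namespace Summit.FinalStateConjecture.FinalStateConjecture.Theorems

open Literature.Geometry.Lorentzian
open scoped Topology Manifold ENNReal ContDiff
open Filter Set

/-! ### Abstract `ℝ≥0∞` bookkeeping -/

section Abstract

-- the operator-norm instance paths on `E4 →L[ℝ] E4 →L[ℝ] ℝ` unify slowly
set_option synthInstance.maxHeartbeats 200000 in
set_option maxHeartbeats 800000 in
/-- `‖D⁰ f (x)‖ₑ = ‖f x‖ₑ` (`norm_iteratedFDeriv_zero`, extended-norm form, for bilinear-form-valued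
maps on `E4`). [folklore] -/
theorem freezing_enorm_iteratedFDeriv_zero (f : E4 → E4 →L[ℝ] E4 →L[ℝ] ℝ) (x : E4) :
    ‖iteratedFDeriv ℝ 0 f x‖ₑ = ‖f x‖ₑ := by
  have h : ‖iteratedFDeriv ℝ 0 f x‖ = ‖f x‖ := norm_iteratedFDeriv_zero
  rw [← ofReal_norm (iteratedFDeriv ℝ 0 f x), h]
  exact ofReal_norm (f x)

/-- Splitting off the first `k` terms of an `ℝ≥0∞` series. [folklore] -/
theorem freezing_sum_add_tail (e : ℕ → ℝ≥0∞) (k : ℕ) :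
    (∑ i ∈ Finset.range k, e i) + ∑' i, e (i + k) = ∑' i, e i :=
  Summable.sum_add_tsum_nat_add' (f := e) (k := k) ENNReal.summable

/-- Finite terms and vanishing tails make an `ℝ≥0∞` series finite. [folklore] -/
theorem freezing_tsum_ne_top_of_tail {e : ℕ → ℝ≥0∞} (hfin : ∀ n, e n ≠ ⊤)
    (htail : Tendsto (fun n ↦ ∑' j, e (j + n)) atTop (𝓝 0)) : ∑' n, e n ≠ ⊤ := by
  obtain ⟨N, hN⟩ := (htail.eventually (gt_mem_nhds zero_lt_one)).exists
  rw [← freezing_sum_add_tail e N]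
  exact ENNReal.add_ne_top.2 ⟨ENNReal.sum_ne_top.2 fun i _ ↦ hfin i, (hN.trans ENNReal.one_lt_top).ne⟩

/-- Each term is bounded by the tail starting at it. [folklore] -/
theorem freezing_le_tail (e : ℕ → ℝ≥0∞) (n : ℕ) : e n ≤ ∑' j, e (j + n) := by
  have := ENNReal.le_tsum (f := fun j ↦ e (j + n)) 0
  simpa using this

/-- Tails are antitone. [folklore] -/
theorem freezing_tail_succ_le (e : ℕ → ℝ≥0∞) (n : ℕ) : ∑' j, e (j + (n + 1)) ≤ ∑' j, e (j + n) := by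
  rw [← freezing_sum_add_tail (fun j ↦ e (j + n)) 1]
  simp only [Finset.range_one, Finset.sum_singleton, zero_add]
  have : (fun j ↦ e (j + (n + 1))) = fun j ↦ e (j + 1 + n) := by
    funext j; congr 1; omega
  rw [this]
  exact le_add_self

/-- Tails are antitone (monotone form). [folklore] -/
theorem freezing_tail_antitone (e : ℕ → ℝ≥0∞) : Antitone fun n ↦ ∑' j, e (j + n) :=
  antitone_nat_of_succ_le fun n ↦ freezing_tail_succ_le e n

/-- A finite telescoping bound: `‖G n − G (n + l)‖ ≤ Σ_{j<l} e (n+j) + Σ_{j<l} e (n+j+1)`.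
[folklore] -/
theorem freezing_enorm_sub_le_sum {V : Type*} [NormedAddCommGroup V] {G : ℕ → V}
    {e : ℕ → ℝ≥0∞} (hG : ∀ n, ‖G n - G (n + 1)‖ₑ ≤ e n + e (n + 1)) (n l : ℕ) :
    ‖G n - G (n + l)‖ₑ ≤
      (∑ j ∈ Finset.range l, e (n + j)) + ∑ j ∈ Finset.range l, e (n + j + 1) := by
  induction l with
  | zero => simp
  | succ l ih =>
    have hstep : ‖G n - G (n + (l + 1))‖ₑ ≤ ‖G n - G (n + l)‖ₑ + ‖G (n + l) - G (n + l + 1)‖ₑ := by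
      rw [show G n - G (n + (l + 1)) = (G n - G (n + l)) + (G (n + l) - G (n + l + 1)) by
        rw [← add_assoc n l 1]; abel]
      exact enorm_add_le (G n - G (n + l)) (G (n + l) - G (n + l + 1))
    calc ‖G n - G (n + (l + 1))‖ₑ
        ≤ ‖G n - G (n + l)‖ₑ + ‖G (n + l) - G (n + l + 1)‖ₑ := hstep
      _ ≤ ((∑ j ∈ Finset.range l, e (n + j)) + ∑ j ∈ Finset.range l, e (n + j + 1)) +
            (e (n + l) + e (n + l + 1)) := add_le_add ih (hG (n + l))
      _ = (∑ j ∈ Finset.range (l + 1), e (n + j)) + ∑ j ∈ Finset.range (l + 1), e (n + j + 1) := by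
          rw [Finset.sum_range_succ, Finset.sum_range_succ]; abel

/-- The telescoping bound by tails: `‖G n − G (n + l)‖ ≤ 2 · Σⱼ e (j + n)`. [folklore] -/
theorem freezing_enorm_sub_le_two_mul_tail {V : Type*} [NormedAddCommGroup V] {G : ℕ → V}
    {e : ℕ → ℝ≥0∞} (hG : ∀ n, ‖G n - G (n + 1)‖ₑ ≤ e n + e (n + 1)) (n l : ℕ) :
    ‖G n - G (n + l)‖ₑ ≤ 2 * ∑' j, e (j + n) := by
  refine (freezing_enorm_sub_le_sum hG n l).trans ?_
  rw [two_mul]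
  refine add_le_add ?_ ?_
  · calc ∑ j ∈ Finset.range l, e (n + j) ≤ ∑' j, e (n + j) := ENNReal.sum_le_tsum _
      _ = ∑' j, e (j + n) := by simp_rw [add_comm n]
  · calc ∑ j ∈ Finset.range l, e (n + j + 1) ≤ ∑' j, e (n + j + 1) := ENNReal.sum_le_tsum _
      _ = ∑' j, e (j + (n + 1)) := by
          congr 1; funext j; congr 1; omega
      _ ≤ ∑' j, e (j + n) := freezing_tail_succ_le e n

/-- **Summable increments converge** (complete normed group): `‖Gₙ − Gₙ₊₁‖ ≤ eₙ + eₙ₊₁` with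
`Σ eₙ < ∞` gives a limit `L` with `‖Gₙ − L‖ ≤ 2 · Σⱼ e_{j+n}`
(`cauchySeq_of_edist_le_of_tsum_ne_top`). [folklore] -/
theorem freezing_exists_tendsto_of_le {V : Type*} [NormedAddCommGroup V] [CompleteSpace V]
    {G : ℕ → V} {e : ℕ → ℝ≥0∞} (hG : ∀ n, ‖G n - G (n + 1)‖ₑ ≤ e n + e (n + 1))
    (hsum : ∑' n, e n ≠ ⊤) :
    ∃ L : V, Tendsto G atTop (𝓝 L) ∧ ∀ n, ‖G n - L‖ₑ ≤ 2 * ∑' j, e (j + n) := by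
  have hd : ∑' n, (e n + e (n + 1)) ≠ ⊤ := by
    rw [ENNReal.tsum_add]
    refine ENNReal.add_ne_top.2 ⟨hsum, ne_top_of_le_ne_top hsum ?_⟩
    have := freezing_tail_succ_le e 0
    simpa using this
  have hC : CauchySeq G := by
    refine cauchySeq_of_edist_le_of_tsum_ne_top (fun n ↦ e n + e (n + 1)) (fun n ↦ ?_) hd
    rw [edist_eq_enorm_sub]
    exact hG n
  obtain ⟨L, hL⟩ := cauchySeq_tendsto_of_complete hC
  refine ⟨L, hL, fun n ↦ ?_⟩
  -- pass to the limit `l → ∞` in the finite telescoping bound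
  have hlim : Tendsto (fun l ↦ ‖G n - G (n + l)‖ₑ) atTop (𝓝 ‖G n - L‖ₑ) := by
    have h1 : Tendsto (fun l ↦ G (n + l)) atTop (𝓝 L) :=
      hL.comp (tendsto_atTop_mono (fun l ↦ Nat.le_add_left l n) tendsto_id)
    exact (tendsto_const_nhds.sub h1).enorm
  exact le_of_tendsto' hlim fun l ↦ freezing_enorm_sub_le_two_mul_tail hG n l

/-- **A function controlled on the dyadic windows by a convergent sequence converges**: if
`‖Pv τ − Gₙ‖ ≤ eₙ` for `τ ∈ [2^(n₀+n), 2^(n₀+n+1)]`, the terms `eₙ` are dominated by vanishing tails and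
`Gₙ → L`, then `Pv → L` along `atTop` (`dyadicSelection_exists_late_window`). [folklore] -/
theorem freezing_tendsto_of_window_bound {V : Type*} [NormedAddCommGroup V] {Pv : ℝ → V}
    {G : ℕ → V} {e : ℕ → ℝ≥0∞} {n₀ : ℕ} {L : V}
    (hPv : ∀ n τ, τ ∈ Set.Icc ((2 : ℝ) ^ (n₀ + n)) ((2 : ℝ) ^ (n₀ + n + 1)) → ‖Pv τ - G n‖ₑ ≤ e n)
    (htail : Tendsto (fun n ↦ ∑' j, e (j + n)) atTop (𝓝 0)) (hG : Tendsto G atTop (𝓝 L)) :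
    Tendsto Pv atTop (𝓝 L) := by
  rw [EMetric.tendsto_nhds]
  intro ε hε
  have hε2 : 0 < ε / 2 := ENNReal.half_pos hε.ne'
  obtain ⟨N₁, hN₁⟩ := ENNReal.tendsto_atTop_zero.1 htail (ε / 2) hε2
  obtain ⟨N₂, hN₂⟩ := (EMetric.tendsto_atTop).1 hG (ε / 2) hε2
  refine eventually_atTop.2 ⟨(2 : ℝ) ^ (n₀ + max N₁ N₂), fun τ hτ ↦ ?_⟩
  obtain ⟨n, hn, hτn⟩ := dyadicSelection_exists_late_window n₀ (max N₁ N₂) τ hτ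
  have h1 : ‖Pv τ - G n‖ₑ ≤ ε / 2 :=
    ((hPv n τ hτn).trans (freezing_le_tail e n)).trans (hN₁ n ((le_max_left _ _).trans hn))
  have h2 : edist (G n) L < ε / 2 := hN₂ n ((le_max_right _ _).trans hn)
  calc edist (Pv τ) L ≤ edist (Pv τ) (G n) + edist (G n) L := edist_triangle _ _ _
    _ < ε / 2 + ε / 2 := by
        rw [edist_eq_enorm_sub]
        exact ENNReal.add_lt_add_of_le_of_lt enorm_ne_top h1 h2
    _ = ε := ENNReal.add_halves ε

end Abstract

/-! ### The concrete instance: fitted parameters converge, the limit is instance-independent -/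

section Instance

variable {𝓢 : Spacetime.{0} 4} (Λ : lorentzGroup) (c : E4) (M' a' : ℝ)
  (Ψ : (boostedKerrExterior Λ c M' a') → 𝓢.carrier)

set_option synthInstance.maxHeartbeats 200000 in
set_option maxHeartbeats 800000 in
/-- **The pullback value at the anchor orbit does not depend on the member**: with
`x = x₀ + τΛe₀`, `(Ψ^*g − g_p)(x) = [(Ψ^*g − g_q)(x) + g_q(x₀)] − g_p(x₀)` for all members `p, q`
(`freezing_deviationExtend_sub`, stationarity). [cite: KerrSchild1965, §2] -/
theorem freezing_dev_anchor_eq {x₀ : E4} (hx₀ : x₀ ∈ (boostedKerrExterior Λ c M' a' : Set E4))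
    (p q : ℝ × ℝ) (τ : ℝ) :
    𝓢.deviationExtend ({boostedKerrBackground Λ c M' a' with bilin := boostedKerrBilin Λ c p.1 p.2} :
        ModelBackground) Ψ (x₀ + τ • (Λ : E4 ≃L[ℝ] E4) (EuclideanSpace.single (0 : Fin 4) (1 : ℝ))) =
      (𝓢.deviationExtend ({boostedKerrBackground Λ c M' a' with bilin := boostedKerrBilin Λ c q.1 q.2} :
          ModelBackground) Ψ (x₀ + τ • (Λ : E4 ≃L[ℝ] E4) (EuclideanSpace.single (0 : Fin 4) (1 : ℝ))) +
        boostedKerrBilin Λ c q.1 q.2 x₀) - boostedKerrBilin Λ c p.1 p.2 x₀ := by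
  set x := x₀ + τ • (Λ : E4 ≃L[ℝ] E4) (EuclideanSpace.single (0 : Fin 4) (1 : ℝ)) with hx
  have hxU : x ∈ (boostedKerrExterior Λ c M' a' : Set E4) := freezing_add_smul_mem_exterior Λ c M' a' hx₀ τ
  have hsub := freezing_deviationExtend_sub (𝓢 := 𝓢) (boostedKerrBackground Λ c M' a') Ψ
    (boostedKerrBilin Λ c p.1 p.2) (boostedKerrBilin Λ c q.1 q.2) x
  rw [Set.indicator_of_mem (show x ∈ ((boostedKerrBackground Λ c M' a').domain : Set E4) from hxU)] at hsub
  have hst : boostedKerrBilin Λ c q.1 q.2 x - boostedKerrBilin Λ c p.1 p.2 x =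
      boostedKerrBilin Λ c q.1 q.2 x₀ - boostedKerrBilin Λ c p.1 p.2 x₀ := by
    rw [hx, KerrSchildChart.boostedKerrBilin_add_smul, KerrSchildChart.boostedKerrBilin_add_smul]
  rw [hst] at hsub
  set Fp := 𝓢.deviationExtend ({boostedKerrBackground Λ c M' a' with bilin := boostedKerrBilin Λ c p.1 p.2} :
      ModelBackground) Ψ x with hFp
  set Fq := 𝓢.deviationExtend ({boostedKerrBackground Λ c M' a' with bilin := boostedKerrBilin Λ c q.1 q.2} :
      ModelBackground) Ψ x with hFq
  calc Fp = (Fp - Fq) + Fq := (sub_add_cancel Fp Fq).symm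
    _ = (boostedKerrBilin Λ c q.1 q.2 x₀ - boostedKerrBilin Λ c p.1 p.2 x₀) + Fq := by rw [hsub]
    _ = (Fq + boostedKerrBilin Λ c q.1 q.2 x₀) - boostedKerrBilin Λ c p.1 p.2 x₀ := by abel

-- long statement; the algebraic / operator-norm instance paths on `E4 →L[ℝ] E4 →L[ℝ] ℝ` unify slowly
set_option synthInstance.maxHeartbeats 200000 in
set_option maxHeartbeats 1600000 in
/-- **Convergence of the fitted parameters and of the anchor pullback value, for one instance.**
Let `Ψ` be a smooth chart on the reference boosted exterior, `x₀ = c + Λy₀` the boosted anchor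
(`y₀ 1 = 0`, `y₀ 2, y₀ 3 ≠ 0`, `max(r₊',0) < r_{a'}(y₀) ≤ ρ`), and `pₙ` members of the window
`m₀ ≤ M ≤ 1/m₀`, `|a| ≤ χM` (`m₀ > 0`) whose window errors
`eₙ(p) = sup_{τ ∈ [2^(n₀+n), 2^(n₀+n+1)]} (δᵏ_ρ(τ; p) + δᵏ_{R τ}(τ; p))` have vanishing tails
`Σⱼ e_{j+n}(p_{j+n}) → 0` and finite terms. Then `pₙ → pinf` for some `pinf` in the window, and the
(member-independent) pullback value `Pv τ = (Ψ^*g − g_{1,0})(x₀ + τΛe₀) + g_{1,0}(x₀)` tends to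
`g_{pinf}(x₀)` as `τ → ∞`. [cite: KerrSchild1965, §2] -/
theorem freezing_instance_limit {m₀ χ : ℝ} (hm₀ : 0 < m₀) {y₀ : E4} (h0 : y₀ 0 = 0) (h1 : y₀ 1 = 0)
    (h2 : y₀ 2 ≠ 0) (h3 : y₀ 3 ≠ 0) (hy₀ : max (Kerr.rPlus M' a') 0 < Kerr.radius a' y₀) {ρ : ℝ}
    (hρ : Kerr.radius a' y₀ ≤ ρ) (R : ℝ → ℝ) (k n₀ : ℕ) {p : ℕ → ℝ × ℝ}
    (hpW : ∀ n, p n ∈ {q : ℝ × ℝ | m₀ ≤ q.1 ∧ q.1 ≤ m₀⁻¹ ∧ |q.2| ≤ χ * q.1})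
    (hfin : ∀ n, (⨆ τ ∈ Set.Icc ((2 : ℝ) ^ (n₀ + n)) ((2 : ℝ) ^ (n₀ + n + 1)),
      (𝓢.truncDeviationCk ({boostedKerrBackground Λ c M' a' with
          bilin := boostedKerrBilin Λ c (p n).1 (p n).2} : ModelBackground) Ψ k ρ τ +
        𝓢.truncDeviationCk ({boostedKerrBackground Λ c M' a' with
          bilin := boostedKerrBilin Λ c (p n).1 (p n).2} : ModelBackground) Ψ k (R τ) τ)) ≠ ⊤)
    (htail : Tendsto (fun n ↦ ∑' j, ⨆ τ ∈ Set.Icc ((2 : ℝ) ^ (n₀ + (j + n))) ((2 : ℝ) ^ (n₀ + (j + n) + 1)),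
      (𝓢.truncDeviationCk ({boostedKerrBackground Λ c M' a' with
          bilin := boostedKerrBilin Λ c (p (j + n)).1 (p (j + n)).2} : ModelBackground) Ψ k ρ τ +
        𝓢.truncDeviationCk ({boostedKerrBackground Λ c M' a' with
          bilin := boostedKerrBilin Λ c (p (j + n)).1 (p (j + n)).2} : ModelBackground) Ψ k (R τ) τ))
      atTop (𝓝 0)) :
    ∃ pinf ∈ {q : ℝ × ℝ | m₀ ≤ q.1 ∧ q.1 ≤ m₀⁻¹ ∧ |q.2| ≤ χ * q.1}, Tendsto p atTop (𝓝 pinf) ∧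
      Tendsto (fun τ : ℝ ↦ 𝓢.deviationExtend ({boostedKerrBackground Λ c M' a' with
            bilin := boostedKerrBilin Λ c 1 0} : ModelBackground) Ψ
          ((c + (Λ : E4 ≃L[ℝ] E4) y₀) + τ • (Λ : E4 ≃L[ℝ] E4) (EuclideanSpace.single (0 : Fin 4) (1 : ℝ))) +
        boostedKerrBilin Λ c 1 0 (c + (Λ : E4 ≃L[ℝ] E4) y₀)) atTop
        (𝓝 (boostedKerrBilin Λ c pinf.1 pinf.2 (c + (Λ : E4 ≃L[ℝ] E4) y₀))) := by
  -- notation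
  set x₀ : E4 := c + (Λ : E4 ≃L[ℝ] E4) y₀ with hx₀
  set e : ℕ → ℝ≥0∞ := fun n ↦ ⨆ τ ∈ Set.Icc ((2 : ℝ) ^ (n₀ + n)) ((2 : ℝ) ^ (n₀ + n + 1)),
      (𝓢.truncDeviationCk ({boostedKerrBackground Λ c M' a' with
          bilin := boostedKerrBilin Λ c (p n).1 (p n).2} : ModelBackground) Ψ k ρ τ +
        𝓢.truncDeviationCk ({boostedKerrBackground Λ c M' a' with
          bilin := boostedKerrBilin Λ c (p n).1 (p n).2} : ModelBackground) Ψ k (R τ) τ) with he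
  set G : ℕ → E4 →L[ℝ] E4 →L[ℝ] ℝ := fun n ↦ boostedKerrBilin Λ c (p n).1 (p n).2 x₀ with hG
  have hx₀U : x₀ ∈ (boostedKerrExterior Λ c M' a' : Set E4) := freezing_boost_mem_exterior hy₀
  -- the anchor translate at time `τ` lies in the slab of radius `ρ` at time `τ`
  have hslab : ∀ (q : ℝ × ℝ) (τ : ℝ),
      x₀ + τ • (Λ : E4 ≃L[ℝ] E4) (EuclideanSpace.single (0 : Fin 4) (1 : ℝ)) ∈ Subtype.val ''
        ({boostedKerrBackground Λ c M' a' with bilin := boostedKerrBilin Λ c q.1 q.2} :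
          ModelBackground).truncTimeSlab ρ τ := by
    intro q τ
    have h0 : x₀ ∈ Subtype.val '' ({boostedKerrBackground Λ c M' a' with
        bilin := boostedKerrBilin Λ c q.1 q.2} : ModelBackground).truncTimeSlab ρ 0 := by
      rw [freezing_mem_slab_iff]
      refine ⟨hx₀U, ?_, ?_⟩
      · rw [hx₀, freezing_poincareInv_boost]
        exact h0
      · rw [hx₀, freezing_poincareInv_boost]; exact hρ
    have := freezing_add_smul_mem_slab Λ c M' a' (boostedKerrBilin Λ c q.1 q.2) h0 τ
    rwa [zero_add] at this
  -- pointwise bound at the anchor translate from the window error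
  have hpt : ∀ (n : ℕ) (τ : ℝ), τ ∈ Set.Icc ((2 : ℝ) ^ (n₀ + n)) ((2 : ℝ) ^ (n₀ + n + 1)) →
      ‖𝓢.deviationExtend ({boostedKerrBackground Λ c M' a' with
          bilin := boostedKerrBilin Λ c (p n).1 (p n).2} : ModelBackground) Ψ
        (x₀ + τ • (Λ : E4 ≃L[ℝ] E4) (EuclideanSpace.single (0 : Fin 4) (1 : ℝ)))‖ₑ ≤ e n := by
    intro n τ hτ
    have hj := freezing_enorm_iteratedFDeriv_le_truncDeviationCk (𝓢 := 𝓢) (boostedKerrBackground Λ c M' a')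
      Ψ (boostedKerrBilin Λ c (p n).1 (p n).2) (Nat.zero_le k) (hslab (p n) τ)
    rw [freezing_enorm_iteratedFDeriv_zero] at hj
    refine hj.trans ?_
    simp only [he]
    exact le_iSup₂_of_le (f := fun τ (_ : τ ∈ Set.Icc ((2 : ℝ) ^ (n₀ + n)) ((2 : ℝ) ^ (n₀ + n + 1))) ↦
      𝓢.truncDeviationCk ({boostedKerrBackground Λ c M' a' with
          bilin := boostedKerrBilin Λ c (p n).1 (p n).2} : ModelBackground) Ψ k ρ τ +
        𝓢.truncDeviationCk ({boostedKerrBackground Λ c M' a' with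
          bilin := boostedKerrBilin Λ c (p n).1 (p n).2} : ModelBackground) Ψ k (R τ) τ) τ hτ le_self_add
  -- consecutive anchor images are close (shared endpoint `2^(n₀+n+1)`)
  have hG : ∀ n, ‖G n - G (n + 1)‖ₑ ≤ e n + e (n + 1) := by
    intro n
    set τ : ℝ := (2 : ℝ) ^ (n₀ + n + 1) with hτ
    have hτn : τ ∈ Set.Icc ((2 : ℝ) ^ (n₀ + n)) ((2 : ℝ) ^ (n₀ + n + 1)) :=
      ⟨pow_le_pow_right₀ one_le_two (Nat.le_succ _), le_rfl⟩
    have hτn1 : τ ∈ Set.Icc ((2 : ℝ) ^ (n₀ + (n + 1))) ((2 : ℝ) ^ (n₀ + (n + 1) + 1)) :=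
      ⟨le_of_eq (by rw [hτ, ← add_assoc]), pow_le_pow_right₀ one_le_two (by omega)⟩
    refine (freezing_enorm_anchor_sub_le Λ c M' a' Ψ hx₀U (p n) (p (n + 1)) τ).trans ?_
    exact add_le_add (hpt n τ hτn) (hpt (n + 1) τ hτn1)
  -- hence the anchor images converge, and so do the parameters
  have hsum : ∑' n, e n ≠ ⊤ := freezing_tsum_ne_top_of_tail hfin htail
  obtain ⟨L, hL, -⟩ := freezing_exists_tendsto_of_le (V := E4 →L[ℝ] E4 →L[ℝ] ℝ) hG hsum
  obtain ⟨pinf, hpinfW, hp, hGpinf⟩ :=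
    freezing_tendsto_of_tendsto_anchor (Λ := Λ) (c := c) hm₀ h1 h2 h3 hpW hL
  refine ⟨pinf, hpinfW, hp, ?_⟩
  rw [← hx₀] at hGpinf
  rw [hGpinf]
  -- the pullback value is within `e n` of `G n` on the `n`-th window
  refine freezing_tendsto_of_window_bound (G := G) (e := e) (n₀ := n₀) (fun n τ hτ ↦ ?_) htail hL
  have heq := freezing_dev_anchor_eq Λ c M' a' Ψ hx₀U (p n) ((1 : ℝ), (0 : ℝ)) τ
  have hb := hpt n τ hτ
  rw [heq] at hb
  simpa only [hG] using hb

/-- **The limit is instance-independent**: two window members `p, q` (so `M > 0`) with the same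
anchor image — in particular the limits of two instances, both equal to the limit of the
member-independent pullback value `Pv` — coincide (`freezing_anchor_injective`). [folklore] -/
theorem freezing_limit_unique {m₀ χ : ℝ} (hm₀ : 0 < m₀) {y₀ : E4} (h1 : y₀ 1 = 0) (h2 : y₀ 2 ≠ 0)
    (h3 : y₀ 3 ≠ 0) {Pv : ℝ → E4 →L[ℝ] E4 →L[ℝ] ℝ} {p q : ℝ × ℝ}
    (hp : p ∈ {q : ℝ × ℝ | m₀ ≤ q.1 ∧ q.1 ≤ m₀⁻¹ ∧ |q.2| ≤ χ * q.1})
    (hq : q ∈ {q : ℝ × ℝ | m₀ ≤ q.1 ∧ q.1 ≤ m₀⁻¹ ∧ |q.2| ≤ χ * q.1})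
    (hPvp : Tendsto Pv atTop (𝓝 (boostedKerrBilin Λ c p.1 p.2 (c + (Λ : E4 ≃L[ℝ] E4) y₀))))
    (hPvq : Tendsto Pv atTop (𝓝 (boostedKerrBilin Λ c q.1 q.2 (c + (Λ : E4 ≃L[ℝ] E4) y₀)))) : p = q :=
  freezing_anchor_injective h1 h2 h3 (hm₀.trans_le hp.1) (hm₀.trans_le hq.1) (tendsto_nhds_unique hPvp hPvq)

end Instance

/-- **Part C, registered form** (`freezingC_le_tail`, the name under which this helper file is
attached to the crux item): each term of an `ℝ≥0∞` sequence is bounded by the tail starting at it.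
[folklore] -/
theorem freezingC_le_tail : ∀ (e : ℕ → ENNReal) (n : ℕ), e n ≤ ∑' j : ℕ, e (j + n) :=
  fun e n ↦ freezing_le_tail e n

end Summit.FinalStateConjecture.FinalStateConjecture.Theorems

end
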